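import Summits.Langlands.Langlands.Theses.PhantomRMYoshida
import Literature.AlgebraicGeometry.Motives.AbelianVarietyExistence
import Literature.AlgebraicGeometry.Motives.AbelianVarietyKerRankProofs
import Literature.AlgebraicGeometry.Motives.AbelianVarietyLie
import Literature.AlgebraicGeometry.Motives.AbelianVarietyIsogenyProofs
import Literature.NumberTheory.DiophantineGeometry.AVIsogenyQuasiInverse

/-!
# Disproof of `FaltingsFinitenessI` — findings (cdisprove, crux stmt-Langlands-15084, cycle 1)

Crux (route `PhantomRMYoshida`, verbatim):
`∀ A : AbelianVariety ℚ, ∃ (n : ℕ) (C : Fin n → AbelianVariety ℚ), ∀ B, IsIsogenous B A → ∃ i, Nonempty (B ≅ C i)`.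

## Verdict of this cycle: NO KILL — the crux is Faltings' Finiteness I over `ℚ`, faithfully typed.

In print (pages read, `lit read book:cornellnd-arithmetic-geometry`): Faltings, *Finiteness theorems for
abelian varieties over number fields* (Cornell–Silverman ch. II) §6 Thm 5 (finitely many isogeny classes of
given dimension with good reduction outside `S`, PDF p. 91) and Thm 6 (Shafarevich: finitely many ISOMORPHISM
classes of given dimension, polarisation degree `d`, good reduction outside `S`, PDF p. 92); the unpolarised
form used by the crux follows with Zarhin's trick (Milne, ibid. ch. V Rem. 16.12, PDF p. 205:
`(B × B^∨)^4` is principally polarised) and Milne Thm 18.7 (PDF p. 211: up to isomorphism an abelian variety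
has only finitely many direct factors): every `B` isogenous to a fixed `A/ℚ` has `dim B = dim A` and good
reduction exactly where `A` has, so `(B × B^∨)^4` runs through finitely many classes, hence so does `B`.

Read-back (W.lean rc 0): `AbelianVariety ℚ` = `X : Over (Spec ℚ)` + `[GrpObj X]` + `IsProper X.hom` +
`GeometricallyIntegral X.hom` (Mathlib classes, no placeholder `Prop` fields); morphisms = homomorphisms of
`ℚ`-group schemes (category induced from `Grp (SchemeOver ℚ)`), so `B ≅ C i` is a group-scheme isomorphism
over `ℚ`; `IsIsogenous B A = ∃ f : B ⟶ A, Surjective f ∧ IsFinite f` on the underlying scheme map. This is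
exactly Faltings 1983 §6 Satz 6 / Milne AV IV Thm 1.1 at `K = ℚ` ("isogenous" is symmetric in
characteristic 0: tree theorem `IsIsogenous.symm_of_charZero`). A theorem in print ⇒ no `¬`-theorem exists
unless the typing leaks; the audit below finds no leak.

## Junk-model audit (why the usual leaks are closed)
* not vacuous: `AbelianVariety ℚ` has inhabitants of every dimension (`exists_abelianVariety_dim_eq_succ`,
  the plane cubic of `WeierstrassCurve.ofJ 37` and its powers) — used below as WITNESSES against
  strengthenings;
* no empty / disconnected junk: `GeometricallyIntegral` forces `IsIntegral` (nonempty, irreducible) after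
  every base field extension; the unit section makes `X` nonempty anyway;
* dimension 0: the only objects are the trivial group (`finite_isoClasses_isogenous_of_dim_eq_zero`,
  p92888, prover seat -2) — finiteness holds there with `n = 1`, and `n = 0` never works (`witness_pos`);
* group structure vs scheme: two `GrpObj` structures on the same proper geometrically integral `X` differ by
  the choice of unit and are isomorphic by translation (rigidity), so counting up to group-scheme iso equals
  counting up to pointed-variety iso — no inflation of classes.

## Kernel-checked content of this file
(a) LOAD-BEARING: `faltingsFinitenessI_false_without_isFinite` — drop `IsFinite` from "isogeny" (keep
    surjective homomorphism) and the statement is FALSE: `E × X_g → E` (projections, `dim X_g = g + 1`)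
    are surjective homomorphisms from pairwise non-isomorphic sources (dimension is an iso invariant).
    So any proof must use finiteness of the isogeny (it is what pins `dim B = dim A`).
(b) TIGHTNESS: `witness_pos` — every witness has `n ≥ 1` (`IsIsogenous.refl`).
(c) STRENGTHENINGS REFUTED:
    * `not_exists_uniform_family` — the quantifier swap `∃ n C, ∀ A B, …` (one finite list for all
      isogeny classes) is false: dimensions are unbounded (`exists_abelianVariety_dim_eq_succ`);
      a fortiori `not_finite_isoClasses_rat` (finitely many abelian varieties over `ℚ` up to iso) is false;
    * `not_isogenyKernelBoundForall` — the `∀ g`-form of the picked line's transfer statement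
      `IsogenyKernelBound` (Lines/Sketch, card isogeny-degree-bound: `∃ g : A ⟶ B` isogeny with
      `kerRank g ≤ N(A)`) is false: `[N+1] : E → E` is an isogeny of degree `(N+1)^2 > N`
      (`kerRank_zsmul_id_holds`, `isIsogeny_zsmul_id_holds_of_charZero`). Only the `∃ g` form is true
      (Masser–Wüstholz 1993); provers must not strengthen K1 when discharging P1/P2.
(e) NEAR-MISSES (sorried, see docstrings): Finiteness I over `AlgebraicClosure ℚ` is false in print but not
    closable in-tree (needs `End E = ℤ` for one explicit curve); the bound `n` cannot be chosen uniformly in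
    `A` over `ℚ` (family `11a1^k`, needs Mordell–Weil groups of 11a1/11a2).

Proposed from this file (Theorems/FaltingsFinitenessI/Negative/, `--supports stmt-Langlands-15084`):
p98134 `FalseWithoutIsFinite.lean` (dim_eq_of_iso, not_covered_of_dim_injective,
surjective_toSchemeHom_of_section, faltingsFinitenessI_witness_pos, faltingsFinitenessI_false_without_isFinite,
not_finite_isoClasses_rat, not_faltingsFinitenessI_uniformFamily); p99616 `NotIsogenyKernelBoundForall.lean`
(exists_isogeny_kerRank_gt, not_isogenyKernelBound_forall). Importable by ideators / planners once applied:
`import Summits.Langlands.Langlands.Theorems.FaltingsFinitenessI.Negative.FalseWithoutIsFinite`.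

## Further load-bearing hypotheses, assessed on paper only (no Lean object available)
* `GeometricallyIntegral` (of `B`) IS load-bearing: with it dropped (proper `ℚ`-group schemes), `A × G_n`
  for the constant groups `G_n = (ℤ/n)_ℚ` are finite surjective over `A` and pairwise non-isomorphic — FALSE.
  Not closable: the tree has no `GrpObj` structure on finite / constant group schemes (kernels `Hom.kerOver f`
  carry only a Hopf algebra on global sections, `AVKernelHopf`), so the variant cannot even be witnessed.
* `IsProper` is probably NOT load-bearing for truth over `ℚ` (a finite cover of a proper `A` is proper; for
  non-proper connected `A` — tori, unipotent, reductive groups — isogenous `ℚ`-forms are still finite in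
  number), only for meaning; nothing filed.
* The base field IS load-bearing (near-miss `faltingsFinitenessI_false_over_algClosure` below); Mathlib's
  `GeometricallyIntegral = geometrically IsIntegral` and `IsProper = separated + universally closed + locally
  of finite type` were re-read (Mathlib `Geometrically/Integral.lean`, `Morphisms/Proper.lean`): no leak.
* The same `[N+1]` witness also kills the `∀ ψ`-form of the sibling card's `BoundedIsogenyExponent`
  ("every isogeny `ψ : A → B` admits `χ` with `ψ ≫ χ = m • 𝟙 A` for one `m = m(A)`"): `Ker [N+1] ⊄ A[m]` once
  `N + 1 > m`; only the `∃ ψ` form (Masser–Wüstholz 1995 Thm II) is true. Not filed separately.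

## Notes for provers (information, not obstructions)
* `Surjective` in `IsIsogeny` is probably NOT load-bearing for truth (a finite homomorphism `B → A` makes
  `B` isogenous onto an abelian subvariety of `A`; finitely many of those up to isogeny, then Finiteness I),
  but it is for the intended meaning; no lemma filed.
* The direction `IsIsogenous B A` (isogeny `B → A`) vs `A → B` is immaterial in characteristic 0
  (`IsIsogenous.symm_of_charZero`, proved in tree).
* Open-problem-shaped strengthening (do not state it): a bound on `n` depending only on `dim A` over `ℚ`
  (`dim A = 1`: `n ≤ 8`, Kenku 1982; `dim A ≥ 2`: tied to uniform boundedness of rational isogenies, open).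
-/

set_option linter.dupNamespace false -- project-wide option (lakefile weak.linter.dupNamespace); `Summit.Langlands.Langlands` is the mandated namespace

open CategoryTheory AlgebraicGeometry
open Literature.AlgebraicGeometry.Motives
open Literature.AlgebraicGeometry.Motives.AbelianVariety

namespace Summit.Langlands.Langlands.Cruxes.FaltingsFinitenessI.Disproof

/-! ## Helpers: dimension is an isomorphism invariant; pigeonhole on dimensions -/

/-- An isomorphism of abelian varieties is an isogeny (its scheme map is an iso, hence surjective
and finite), so it preserves `dim` (`dim_eq_of_isIsogeny`). [folklore] -/
theorem dim_eq_of_iso {A B : AbelianVariety ℚ} (e : A ≅ B) : A.dim = B.dim := by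
  haveI : IsIso (Hom.toSchemeHom e.hom) :=
    ⟨Hom.toSchemeHom e.inv, by rw [← toSchemeHom_comp, e.hom_inv_id]; rfl,
      by rw [← toSchemeHom_comp, e.inv_hom_id]; rfl⟩
  exact dim_eq_of_isIsogeny (f := e.hom) ⟨inferInstance, inferInstance⟩

/-- Pigeonhole: a family `B : ℕ → AbelianVariety ℚ` with pairwise distinct dimensions is not covered,
up to isomorphism, by any finite list `C : Fin n → AbelianVariety ℚ`. [folklore] -/
theorem not_covered_of_dim_injective (B : ℕ → AbelianVariety ℚ)
    (hB : Function.Injective fun g => (B g).dim) (n : ℕ) (C : Fin n → AbelianVariety ℚ)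
    (h : ∀ g, ∃ i, Nonempty (B g ≅ C i)) : False := by
  choose f hf using h
  refine not_injective_infinite_finite f fun g₁ g₂ hg => hB ?_
  obtain ⟨e₁⟩ := hf g₁
  obtain ⟨e₂⟩ := hf g₂
  change (B g₁).dim = (B g₂).dim
  rw [dim_eq_of_iso e₁, dim_eq_of_iso e₂, hg]

/-- A split epimorphism of abelian varieties has surjective underlying scheme map. [folklore] -/
theorem surjective_toSchemeHom_of_section {A B : AbelianVariety ℚ} (p : A ⟶ B) (s : B ⟶ A)
    (h : s ≫ p = 𝟙 B) : Surjective (Hom.toSchemeHom p) := by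
  have h' : Hom.toSchemeHom s ≫ Hom.toSchemeHom p = 𝟙 B.X.left := by
    rw [← toSchemeHom_comp, h]; rfl
  refine ⟨fun y => ⟨(Hom.toSchemeHom s).base y, ?_⟩⟩
  have := congrArg (fun q : B.X.left ⟶ B.X.left => q.base y) h'
  simpa using this

/-! ## (b) Tightness: every witness list is nonempty -/

/-- `n = 0` never witnesses the crux at any `A`: `A` itself is isogenous to `A`. [folklore] -/
theorem witness_pos (A : AbelianVariety ℚ) (n : ℕ) (C : Fin n → AbelianVariety ℚ)
    (h : ∀ B : AbelianVariety ℚ, IsIsogenous B A → ∃ i, Nonempty (B ≅ C i)) : 0 < n := by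
  obtain ⟨i, -⟩ := h A (IsIsogenous.refl A)
  exact i.pos

/-! ## (a) Load-bearing analysis: finiteness of the isogeny -/

/-- The crux with `IsFinite` dropped from "isogeny": finiteness of isomorphism classes of abelian
varieties `B` admitting a SURJECTIVE homomorphism `B → A`. -/
def FaltingsFinitenessIWithoutIsFinite : Prop :=
  ∀ A : AbelianVariety ℚ, ∃ (n : ℕ) (C : Fin n → AbelianVariety ℚ), ∀ B : AbelianVariety ℚ,
    (∃ f : B ⟶ A, Surjective (Hom.toSchemeHom f)) → ∃ i, Nonempty (B ≅ C i)

/-- **Any proof must use `IsFinite`.** Without it the statement is false at EVERY `A`: the projections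
`A × X_g → A` (`dim X_g = g + 1`, `exists_abelianVariety_dim_eq_succ`) are surjective homomorphisms
(split by `prodLift (𝟙 A) 0`) from sources of pairwise distinct dimension `dim A + g + 1`
(`dim_prod`), and dimension is an isomorphism invariant. [folklore] -/
theorem faltingsFinitenessI_false_without_isFinite : ¬ FaltingsFinitenessIWithoutIsFinite := by
  intro h
  obtain ⟨A, -⟩ := exists_abelianVariety_dim_eq_one ℚ
  obtain ⟨n, C, hC⟩ := h A
  choose X hX using fun g => exists_abelianVariety_dim_eq_succ ℚ g
  refine not_covered_of_dim_injective (fun g => A.prod (X g)) ?_ n C fun g => hC _ ⟨fst A (X g), ?_⟩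
  · intro g₁ g₂ hg
    change (A.prod (X g₁)).dim = (A.prod (X g₂)).dim at hg
    rw [dim_prod, dim_prod, hX, hX] at hg
    omega
  · exact surjective_toSchemeHom_of_section _ (prodLift (𝟙 A) 0) (prodLift_fst _ _)

/-! ## (c) Natural strengthenings refuted -/

/-- Quantifier swap of the crux: ONE finite list serving every isogeny class. -/
def FaltingsFinitenessIUniformFamily : Prop :=
  ∃ (n : ℕ) (C : Fin n → AbelianVariety ℚ), ∀ A B : AbelianVariety ℚ,
    IsIsogenous B A → ∃ i, Nonempty (B ≅ C i)

/-- There are NOT finitely many abelian varieties over `ℚ` up to isomorphism (dimensions are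
unbounded: `exists_abelianVariety_dim_eq_succ`). [folklore] -/
theorem not_finite_isoClasses_rat :
    ¬ ∃ (n : ℕ) (C : Fin n → AbelianVariety ℚ), ∀ A : AbelianVariety ℚ, ∃ i, Nonempty (A ≅ C i) := by
  rintro ⟨n, C, hC⟩
  choose X hX using fun g => exists_abelianVariety_dim_eq_succ ℚ g
  refine not_covered_of_dim_injective X ?_ n C fun g => hC (X g)
  intro g₁ g₂ hg
  change (X g₁).dim = (X g₂).dim at hg
  rw [hX, hX] at hg
  omega

/-- **The quantifier-swapped crux is false**: `∃ n C, ∀ A B, IsIsogenous B A → ∃ i, B ≅ C i` fails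
(take `B = A`, `IsIsogenous.refl`, and `not_finite_isoClasses_rat`). The crux's `n, C` must depend on
`A`. [folklore] -/
theorem not_faltingsFinitenessIUniformFamily : ¬ FaltingsFinitenessIUniformFamily := by
  rintro ⟨n, C, hC⟩
  exact not_finite_isoClasses_rat ⟨n, C, fun A => hC A A (IsIsogenous.refl A)⟩

/-- The `∀ g`-form of the picked line's transfer statement `IsogenyKernelBound`
(Lines/Sketch, card `isogeny-degree-bound`): EVERY isogeny out of `A` onto an isogenous `B` has
kernel rank `≤ N(A)`. -/
def IsogenyKernelBoundForall : Prop :=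
  ∀ A : AbelianVariety ℚ, ∃ N : ℕ, ∀ B : AbelianVariety ℚ, IsIsogenous B A →
    ∀ g : A ⟶ B, IsIsogeny g → Hom.kerRank g ≤ N

/-- **`IsogenyKernelBoundForall` is false** (only the `∃ g` form, Masser–Wüstholz 1993, is true):
on an elliptic curve `E/ℚ` (`exists_abelianVariety_dim_eq_one`) the isogeny `[N+1]`
(`isIsogeny_zsmul_id_holds_of_charZero`) has `kerRank = (N+1)^2 > N` (`kerRank_zsmul_id_holds`,
Görtz–Wedhorn II Prop. 27.186). [cite: GortzWedhorn2023, Prop. 27.186 (p. 887)] -/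
theorem not_isogenyKernelBoundForall : ¬ IsogenyKernelBoundForall := by
  intro h
  obtain ⟨E, hE⟩ := exists_abelianVariety_dim_eq_one ℚ
  obtain ⟨N, hN⟩ := h E
  have hne : ((N : ℤ) + 1) ≠ 0 := by positivity
  have hiso : IsIsogeny ((((N : ℤ) + 1)) • 𝟙 E) := isIsogeny_zsmul_id_holds_of_charZero _ (by
    exact_mod_cast Nat.succ_ne_zero N)
  have hk : Hom.kerRank ((((N : ℤ) + 1)) • 𝟙 E) = ((N : ℤ) + 1).natAbs ^ (2 * E.dim) :=
    kerRank_zsmul_id_holds E _ hne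
  have hle := hN E (IsIsogenous.refl E) _ hiso
  rw [hk, hE] at hle
  have hab : ((N : ℤ) + 1).natAbs = N + 1 := by omega
  rw [hab, Nat.mul_one, Nat.pow_two] at hle
  nlinarith [hle]

/-! ## (e) Near-misses: false in print, not closable in-tree today -/

/-- NEAR-MISS (base field is load-bearing). Finiteness I is FALSE over an algebraically closed field of
characteristic 0: for an elliptic curve `E/ℚ̄` with `End E = ℤ` the quotients `E/C_p` by cyclic subgroups
of prime order `p` are pairwise non-isomorphic (an iso `E/C_p ≅ E/C_q` composed with the quotient maps
and a quasi-inverse gives an endomorphism of `E` of degree `p q m^2`, not a square), yet all isogenous to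
`E`. Obstruction to closing: the tree constructs `E` (`exists_abelianVariety_dim_eq_one`) and the
quotients (`exists_quotient_isogeny_holds`), but `End E = ℤ` for an explicit curve over `ℚ̄` is out of
reach (no reduction mod `p` / complex uniformisation for the scheme-theoretic `AbelianVariety`). Tried:
separating the quotients by `kerRank` alone — impossible, all have the same degree data. -/
theorem faltingsFinitenessI_false_over_algClosure :
    ¬ ∀ A : AbelianVariety (AlgebraicClosure ℚ), ∃ (n : ℕ)
      (C : Fin n → AbelianVariety (AlgebraicClosure ℚ)), ∀ B : AbelianVariety (AlgebraicClosure ℚ),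
      IsIsogenous B A → ∃ i, Nonempty (B ≅ C i) := by
  sorry

/-- NEAR-MISS (the bound is not uniform in `A`). `∃ n, ∀ A, ∃ C : Fin n → _, …` is FALSE in print over
`ℚ`: for `E = 11a1` (`E(ℚ) ≅ ℤ/5`) and the 5-isogenous `E' = 11a2` (`E'(ℚ) = 0`, Cremona / LMFDB 11.a)
the `k + 1` varieties `E^j × E'^(k-j)`, `0 ≤ j ≤ k`, are isogenous to `E^k` and pairwise non-isomorphic
(their Mordell–Weil groups `(ℤ/5)^j` differ). Obstruction to closing: Mordell–Weil groups of explicit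
curves as `AbelianVariety.Points` are not computable in-tree. -/
theorem not_faltingsFinitenessI_uniform_bound :
    ¬ ∃ n : ℕ, ∀ A : AbelianVariety ℚ, ∃ C : Fin n → AbelianVariety ℚ, ∀ B : AbelianVariety ℚ,
      IsIsogenous B A → ∃ i, Nonempty (B ≅ C i) := by
  sorry

end Summit.Langlands.Langlands.Cruxes.FaltingsFinitenessI.Disproof
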